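import Literature.IUT.LogVolume.Theorem110StepII
import Literature.IUT.LogVolume.Theorem110StepIII
import HarnessLib

/-!
# The fork at [IUTchIII] Corollary 3.12 — checks: the Step (ii)/(iii) input structures of
# [IUTchIV] Thm. 1.10 are satisfiable (non-vacuity)

Record-only file (D-0012) of the abc-iut cell; TAKES NO SIDE. `Theorem110StepII.lean` /
`Theorem110StepIII.lean` (abc-iut-S3) assemble the three log-different displays of Step (ii) and the
`log(𝔰^ℚ)` bound of Step (iii) from per-place input structures `Thm110StepII.PlaceData`,
`Thm110StepIII.StepIIIData`. This file exhibits toy instances of both (one place, `p = 2`, `e = f = 1`,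
`d = 0`, good reduction, `n = 1`; `l = 5`, `V_ℚ^dst = {2}`), so their field constraints (fundamental identity
with `ℕ`-casts, Prop. 1.3 (i) shape, (D6), …) are jointly satisfiable and the assembled theorems are not
vacuous. The toy numbers are NOT invariants of any number field tower (referee vacuity check only).
-/

noncomputable section

namespace Summit.ABC

namespace IUTFork

open Literature.IUT.LogVolume

/-- A toy `PlaceData` (Step (ii)): `L = L₀`, one place over `2`, unramified, good.
[claim: Mochizuki2012, status: disputed] -/
def toyPlaceData : Thm110StepII.PlaceData Unit (fun _ => Unit) where
  deg0 := 1
  deg0_pos := one_pos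
  n := 1
  n_pos := one_pos
  p := fun _ => 2
  two_le_p := fun _ => le_rfl
  e0 := fun _ => 1
  e0_pos := fun _ => one_pos
  f0 := fun _ => 1
  f0_pos := fun _ => one_pos
  d0 := fun _ => 0
  d0_nonneg := fun _ => le_rfl
  bad := fun _ => false
  erel := fun _ _ => 1
  erel_pos := fun _ _ => one_pos
  frel := fun _ _ => 1
  frel_pos := fun _ _ => one_pos
  d := fun _ _ => 0
  fund := fun _ => by simp

/-- The toy `PlaceData` satisfies the hypothesis of `first_display` (Prop. 1.3 (i) shape), so the first
display holds for it non-vacuously. [claim: Mochizuki2012, status: disputed] -/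
theorem toyPlaceData_first_display :
    toyPlaceData.logDiff0 + toyPlaceData.logCond0 ≤ toyPlaceData.logDiff + toyPlaceData.logCond :=
  toyPlaceData.first_display (fun _ _ => by simp [toyPlaceData])

/-- A toy `StepIIIData` (Step (iii)): one place of `F_tpd` over `2`, `l = 5`, `V_ℚ^dst = {2}`.
[claim: Mochizuki2012, status: disputed] -/
def toyStepIIIData : Thm110StepIII.StepIIIData Unit where
  deg0 := 1
  deg0_pos := one_pos
  dmod := 1
  deg0_le_dmod := le_rfl
  l := 5
  l_pos := by norm_num
  p := fun _ => 2
  p_prime := fun _ => Nat.prime_two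
  e := fun _ => 1
  e_pos := fun _ => one_pos
  f := fun _ => 1
  f_pos := fun _ => one_pos
  d := fun _ => 0
  d_nonneg := fun _ => le_rfl
  bad := fun _ => false
  fund := fun q => by
    by_cases hq : (2 : ℕ) = q
    · subst hq; simp
    · simp [hq]
  prop13i := fun _ => by simp
  ramified_of_d_pos := fun _ h => absurd h (lt_irrefl _)
  dst := {2}
  dst_prime := fun q hq => by rw [Finset.mem_singleton] at hq; subst hq; exact Nat.prime_two
  D6 := fun q hq => by rw [Finset.mem_singleton] at hq; subst hq; exact Or.inl ⟨3 * 5 * 5, by norm_num⟩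

/-- **Non-vacuity of the Step (ii)/(iii) input structures**: both are inhabited, and the Step (iii)
bound holds for the toy instance. [claim: Mochizuki2012, status: disputed] -/
theorem stepData_satisfiable :
    Nonempty (Thm110StepII.PlaceData Unit (fun _ => Unit)) ∧ Nonempty (Thm110StepIII.StepIIIData Unit) ∧
      toyStepIIIData.logsQ ≤ 2 * toyStepIIIData.dmod * (toyStepIIIData.logDiffTpd + toyStepIIIData.logCondTpd)
        + Real.log (2 * 3 * 5 * (toyStepIIIData.l : ℝ)) :=
  ⟨⟨toyPlaceData⟩, ⟨toyStepIIIData⟩, toyStepIIIData.logsQ_le_printed⟩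

end IUTFork

end Summit.ABC

end
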